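import Summits.Ventures.PercRepro.C026HubTwo

/-!
# Theorem R (R0): a hub with parallel classes — `Δ_CF(G + v_{a^k b^l}) = (2^k + 2^l − 1)·Δ_CF(G)` (p6, gen 14)

mine-3's THEOREM R (R0) (INBOX 6152): a vertex `v` joined to the mark `a` by `k ≥ 0` edges and to the mark
`b` by `l ≥ 0` edges and to nothing else multiplies the C-026 slack by `2^k + 2^l − 1`; `k = l = 1` is
Theorem H (H1) `slackCF_hub2_ab` (factor `3`), `l = 0` is the pendant class (factor `2^k`).

The hub graph is `G.hubPar v a b k l` on the edge type `E ⊕ (Fin k ⊕ Fin l)` (the `a`-class `Fin k`, the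
`b`-class `Fin l`).  Its configurations are the pairs `(ω, σ)` (`Sum.elim ω σ`), and in the hub state `σ`
the graph is hub-like over `G` (`hubLike_hubPar`) with the OPEN reach «some `a`-edge open and `x ~ a`, or
some `b`-edge open and `x ~ b`».  The slice of a hub-like graph depends only on the two Booleans of the open
reach (`sliceCF_of_reach`: the closed reach never matters, because the closed-cluster clauses of `N_AB`
already exclude `c ≁̄ a`, `c ≁̄ b`): it is `0` when both classes have an open edge and `Δ_CF(G)` otherwise.
Summing over the `2^{k+l}` states (`slackCF_hubPar_eq_sum`, `card_filter_sumElim`) counts the states with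
at most one open class: `2^k + 2^l − 1` (`card_not_both`).
-/

namespace PercRepro

open Finset

namespace MultiGraph

section HubPar

variable {V E : Type*} (G : MultiGraph V E)

/-- **The parallel hub** `G + v_{a^k b^l}`: `k` edges `v–a` (the class `Fin k`) and `l` edges `v–b`
(the class `Fin l`) added to `G`. -/
def hubPar (v a b : V) (k l : ℕ) : MultiGraph V (E ⊕ (Fin k ⊕ Fin l)) where
  fst
    | Sum.inl e => G.fst e
    | Sum.inr _ => v
  snd
    | Sum.inl e => G.snd e
    | Sum.inr (Sum.inl _) => a
    | Sum.inr (Sum.inr _) => b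

/-- The open reach of the hub state `σ`: `x` reaches the hub iff some `a`-edge is open and `x ~ a`, or
some `b`-edge is open and `x ~ b`. -/
def parReach {k l : ℕ} (ω : Config E) (σ : Config (Fin k ⊕ Fin l)) (a b x : V) : Prop :=
  (∃ i, σ (Sum.inl i) = true ∧ G.Conn ω x a) ∨ (∃ j, σ (Sum.inr j) = true ∧ G.Conn ω x b)

variable {G}

/-- The first end of an old edge. -/
@[simp] theorem hubPar_fst_inl {v a b : V} {k l : ℕ} (e : E) :
    (G.hubPar v a b k l).fst (Sum.inl e) = G.fst e := rfl

/-- The second end of an old edge. -/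
@[simp] theorem hubPar_snd_inl {v a b : V} {k l : ℕ} (e : E) :
    (G.hubPar v a b k l).snd (Sum.inl e) = G.snd e := rfl

/-- Every hub edge starts at `v`. -/
@[simp] theorem hubPar_fst_inr {v a b : V} {k l : ℕ} (i : Fin k ⊕ Fin l) :
    (G.hubPar v a b k l).fst (Sum.inr i) = v := rfl

/-- An `a`-class edge ends at `a`. -/
@[simp] theorem hubPar_snd_inl_inl {v a b : V} {k l : ℕ} (i : Fin k) :
    (G.hubPar v a b k l).snd (Sum.inr (Sum.inl i)) = a := rfl

/-- A `b`-class edge ends at `b`. -/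
@[simp] theorem hubPar_snd_inr_inr {v a b : V} {k l : ℕ} (j : Fin l) :
    (G.hubPar v a b k l).snd (Sum.inr (Sum.inr j)) = b := rfl

/-- The reach is closed under `G`-connectivity. -/
theorem parReach_of_conn {k l : ℕ} {ω : Config E} {σ : Config (Fin k ⊕ Fin l)} {a b x y : V}
    (h : G.parReach ω σ a b x) (hxy : G.Conn ω x y) : G.parReach ω σ a b y := by
  rcases h with ⟨i, hi, hx⟩ | ⟨j, hj, hx⟩
  · exact Or.inl ⟨i, hi, hxy.symm.trans hx⟩
  · exact Or.inr ⟨j, hj, hxy.symm.trans hx⟩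

/-- A path of `G` is a path of the hub graph (any hub state). -/
theorem conn_hubPar_of_conn {v a b : V} {k l : ℕ} {ω : Config E} (σ : Config (Fin k ⊕ Fin l))
    {x y : V} (h : G.Conn ω x y) : (G.hubPar v a b k l).Conn (Sum.elim ω σ) x y := by
  unfold Conn at h ⊢
  induction h with
  | refl => exact Relation.ReflTransGen.refl
  | tail _ hyz ih =>
    refine ih.tail ?_
    obtain ⟨e, he, hend⟩ := hyz
    exact ⟨Sum.inl e, he, by simpa using hend⟩

/-- The open hub edge `v–a` of the class `Fin k`. -/
theorem conn_hubPar_v_a {v a b : V} {k l : ℕ} (ω : Config E) {σ : Config (Fin k ⊕ Fin l)} {i : Fin k}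
    (hi : σ (Sum.inl i) = true) : (G.hubPar v a b k l).Conn (Sum.elim ω σ) v a :=
  Conn.of_openAdj ⟨Sum.inr (Sum.inl i), hi, Or.inl ⟨rfl, rfl⟩⟩

/-- The open hub edge `v–b` of the class `Fin l`. -/
theorem conn_hubPar_v_b {v a b : V} {k l : ℕ} (ω : Config E) {σ : Config (Fin k ⊕ Fin l)} {j : Fin l}
    (hj : σ (Sum.inr j) = true) : (G.hubPar v a b k l).Conn (Sum.elim ω σ) v b :=
  Conn.of_openAdj ⟨Sum.inr (Sum.inr j), hj, Or.inl ⟨rfl, rfl⟩⟩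

/-- The reach gives a path to the hub. -/
theorem conn_hubPar_v_of_reach {v a b : V} {k l : ℕ} {ω : Config E} {σ : Config (Fin k ⊕ Fin l)} {x : V}
    (h : G.parReach ω σ a b x) : (G.hubPar v a b k l).Conn (Sum.elim ω σ) x v := by
  rcases h with ⟨i, hi, hx⟩ | ⟨j, hj, hx⟩
  · exact (conn_hubPar_of_conn σ hx).trans (conn_hubPar_v_a ω hi).symm
  · exact (conn_hubPar_of_conn σ hx).trans (conn_hubPar_v_b ω hj).symm

/-- **The forward invariant**: along a path of the hub graph from `x ≠ v`, every vertex `z ≠ v` is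
`G`-joined to `x` or both reach the hub, and `z = v` means `x` reaches the hub. -/
theorem hubPar_conn_forward {v a b : V} {k l : ℕ} (hv : G.Isolated v) (hav : a ≠ v) (hbv : b ≠ v)
    {ω : Config E} {σ : Config (Fin k ⊕ Fin l)} {x z : V}
    (h : (G.hubPar v a b k l).Conn (Sum.elim ω σ) x z) (hx : x ≠ v) :
    (z ≠ v → G.Conn ω x z ∨ (G.parReach ω σ a b x ∧ G.parReach ω σ a b z)) ∧
      (z = v → G.parReach ω σ a b x) := by
  unfold Conn at h
  induction h with
  | refl => exact ⟨fun _ => Or.inl (Conn.refl G ω x), fun hxv => absurd hxv hx⟩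
  | @tail y z _ hyz ih =>
    obtain ⟨e, he, hend⟩ := hyz
    rcases e with e | i | j
    · -- an edge of `G`: neither end is `v`
      have hy : y ≠ v := by
        rcases hend with ⟨h1, _⟩ | ⟨_, h2⟩
        · simp only [hubPar_fst_inl] at h1; exact h1 ▸ (hv e).1
        · simp only [hubPar_snd_inl] at h2; exact h2 ▸ (hv e).2
      have hz : z ≠ v := by
        rcases hend with ⟨_, h2⟩ | ⟨h1, _⟩
        · simp only [hubPar_snd_inl] at h2; exact h2 ▸ (hv e).2
        · simp only [hubPar_fst_inl] at h1; exact h1 ▸ (hv e).1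
      have hyz' : G.Conn ω y z := by
        simp only [hubPar_fst_inl, hubPar_snd_inl] at hend
        exact Conn.of_openAdj ⟨e, he, hend⟩
      refine ⟨fun _ => ?_, fun hzv => absurd hzv hz⟩
      rcases ih.1 hy with hxy | ⟨hrx, hry⟩
      · exact Or.inl (hxy.trans hyz')
      · exact Or.inr ⟨hrx, parReach_of_conn hry hyz'⟩
    · -- a hub edge `v–a`
      have hi : σ (Sum.inl i) = true := he
      simp only [hubPar_fst_inr, hubPar_snd_inl_inl] at hend
      rcases hend with ⟨hyv, hza⟩ | ⟨hzv, hya⟩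
      · -- from `v` to `a`
        subst hza
        have hrx := ih.2 hyv.symm
        exact ⟨fun _ => Or.inr ⟨hrx, Or.inl ⟨i, hi, Conn.refl G ω a⟩⟩, fun hav' => absurd hav' hav⟩
      · -- from `a` to `v`
        subst hzv hya
        refine ⟨fun h => absurd rfl h, fun _ => ?_⟩
        rcases ih.1 hav with hxa | ⟨hrx, _⟩
        · exact Or.inl ⟨i, hi, hxa⟩
        · exact hrx
    · -- a hub edge `v–b`
      have hj : σ (Sum.inr j) = true := he
      simp only [hubPar_fst_inr, hubPar_snd_inr_inr] at hend
      rcases hend with ⟨hyv, hzb⟩ | ⟨hzv, hyb⟩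
      · subst hzb
        have hrx := ih.2 hyv.symm
        exact ⟨fun _ => Or.inr ⟨hrx, Or.inr ⟨j, hj, Conn.refl G ω b⟩⟩, fun hbv' => absurd hbv' hbv⟩
      · subst hzv hyb
        refine ⟨fun h => absurd rfl h, fun _ => ?_⟩
        rcases ih.1 hbv with hxb | ⟨hrx, _⟩
        · exact Or.inr ⟨j, hj, hxb⟩
        · exact hrx

/-- **The parallel hub is hub-like** over `G` in every state, with the open reach `parReach`. -/
theorem hubLike_hubPar {v a b : V} {k l : ℕ} (hv : G.Isolated v) (hav : a ≠ v) (hbv : b ≠ v)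
    (ω : Config E) (σ : Config (Fin k ⊕ Fin l)) :
    HubLike G v (G.hubPar v a b k l) ω (Sum.elim ω σ) (G.parReach ω σ a b) where
  conn_iff x y hx hy := by
    constructor
    · intro h
      exact (hubPar_conn_forward hv hav hbv h hx).1 hy
    · rintro (h | ⟨hrx, hry⟩)
      · exact conn_hubPar_of_conn σ h
      · exact (conn_hubPar_v_of_reach hrx).trans (conn_hubPar_v_of_reach hry).symm
  conn_v_iff x hx := by
    constructor
    · intro h
      exact (hubPar_conn_forward hv hav hbv h hx).2 rfl
    · exact conn_hubPar_v_of_reach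

/-- The complement of an assembled configuration. -/
theorem compl_sumElim {k l : ℕ} (ω : Config E) (σ : Config (Fin k ⊕ Fin l)) :
    (Sum.elim ω σ)ᶜ = Sum.elim ωᶜ σᶜ := by
  funext e
  cases e <;> rfl

end HubPar

section ReachSlice

variable {V E : Type*} [Fintype E] {G : MultiGraph V E}

omit [Fintype E] in
/-- The closed reach never matters: the closed-cluster clauses of `N_AB` already say `c ≁̄ a`, `c ≁̄ b`. -/
theorem closed_reach_clauses_iff (ω : Config E) (ρa' ρb' : Bool) (a b c : V) :
    (¬ (G.Conn ωᶜ c a ∨ (((ρa' = true ∧ G.Conn ωᶜ c a) ∨ (ρb' = true ∧ G.Conn ωᶜ c b)) ∧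
          ((ρa' = true ∧ G.Conn ωᶜ a a) ∨ (ρb' = true ∧ G.Conn ωᶜ a b)))) ∧
      ¬ (G.Conn ωᶜ c b ∨ (((ρa' = true ∧ G.Conn ωᶜ c a) ∨ (ρb' = true ∧ G.Conn ωᶜ c b)) ∧
          ((ρa' = true ∧ G.Conn ωᶜ b a) ∨ (ρb' = true ∧ G.Conn ωᶜ b b))))) ↔
      (¬ G.Conn ωᶜ c a ∧ ¬ G.Conn ωᶜ c b) := by
  tauto

omit [Fintype E] in
/-- Open reach through `a` only: the cell `ab|c`. -/
theorem reach_a_cell_ab_iff (ω : Config E) (a b c : V) :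
    ((G.Conn ω a b ∨ (G.Conn ω a a ∧ G.Conn ω b a)) ∧ ¬ (G.Conn ω a c ∨ (G.Conn ω a a ∧ G.Conn ω c a))) ↔
      (G.Conn ω a b ∧ ¬ G.Conn ω a c) := by
  have h1 : G.Conn ω b a → G.Conn ω a b := Conn.symm
  have h2 : G.Conn ω c a → G.Conn ω a c := Conn.symm
  tauto

omit [Fintype E] in
/-- Open reach through `a` only: the cell `ac|b`. -/
theorem reach_a_cell_ac_iff (ω : Config E) (a b c : V) :
    ((G.Conn ω c a ∨ (G.Conn ω c a ∧ G.Conn ω a a)) ∧ ¬ (G.Conn ω c b ∨ (G.Conn ω c a ∧ G.Conn ω b a))) ↔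
      (G.Conn ω c a ∧ ¬ G.Conn ω c b) := by
  have h1 : G.Conn ω c a → G.Conn ω b a → G.Conn ω c b := fun h h' => h.trans h'.symm
  tauto

omit [Fintype E] in
/-- Open reach through `a` only: the cell `bc|a`. -/
theorem reach_a_cell_bc_iff (ω : Config E) (a b c : V) :
    ((G.Conn ω c b ∨ (G.Conn ω c a ∧ G.Conn ω b a)) ∧ ¬ (G.Conn ω c a ∨ (G.Conn ω c a ∧ G.Conn ω a a))) ↔
      (G.Conn ω c b ∧ ¬ G.Conn ω c a) := by
  tauto

omit [Fintype E] in
/-- Open reach through `a` only: the cell `N_AB`. -/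
theorem reach_a_cell_n_iff (ω : Config E) (a b c : V) :
    ((G.Conn ω a b ∨ (G.Conn ω a a ∧ G.Conn ω b a)) ∧ ¬ G.Conn ωᶜ c a ∧ ¬ G.Conn ωᶜ c b) ↔
      (G.Conn ω a b ∧ ¬ G.Conn ωᶜ c a ∧ ¬ G.Conn ωᶜ c b) := by
  have h1 : G.Conn ω b a → G.Conn ω a b := Conn.symm
  tauto

omit [Fintype E] in
/-- Open reach through `b` only: the cell `ab|c`. -/
theorem reach_b_cell_ab_iff (ω : Config E) (a b c : V) :
    ((G.Conn ω a b ∨ (G.Conn ω a b ∧ G.Conn ω b b)) ∧ ¬ (G.Conn ω a c ∨ (G.Conn ω a b ∧ G.Conn ω c b))) ↔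
      (G.Conn ω a b ∧ ¬ G.Conn ω a c) := by
  have h1 : G.Conn ω a b → G.Conn ω c b → G.Conn ω a c := fun h h' => h.trans h'.symm
  tauto

omit [Fintype E] in
/-- Open reach through `b` only: the cell `ac|b`. -/
theorem reach_b_cell_ac_iff (ω : Config E) (a b c : V) :
    ((G.Conn ω c a ∨ (G.Conn ω c b ∧ G.Conn ω a b)) ∧ ¬ (G.Conn ω c b ∨ (G.Conn ω c b ∧ G.Conn ω b b))) ↔
      (G.Conn ω c a ∧ ¬ G.Conn ω c b) := by
  tauto

omit [Fintype E] in
/-- Open reach through `b` only: the cell `N_AB`. -/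
theorem reach_b_cell_n_iff (ω : Config E) (a b c : V) :
    ((G.Conn ω a b ∨ (G.Conn ω a b ∧ G.Conn ω b b)) ∧ ¬ G.Conn ωᶜ c a ∧ ¬ G.Conn ωᶜ c b) ↔
      (G.Conn ω a b ∧ ¬ G.Conn ωᶜ c a ∧ ¬ G.Conn ωᶜ c b) := by
  tauto

open Classical in
/-- **The slice of a hub-like graph through the reach Booleans**: with the open reach
`(ρa ∧ x ~ a) ∨ (ρb ∧ x ~ b)` and ANY closed reach of the same shape, the slice is `0` when both
`ρa`, `ρb` hold (the hub joins `a` to `b`) and `Δ_CF(G)` otherwise. -/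
theorem sliceCF_of_reach {E' : Type*} [Fintype E'] {H : MultiGraph V E'} {f : Config E → Config E'}
    {v a b c : V} (hav : a ≠ v) (hbv : b ≠ v) (hcv : c ≠ v) (ρa ρb ρa' ρb' : Bool)
    (hH : ∀ ω, HubLike G v H ω (f ω)
      (fun x => (ρa = true ∧ G.Conn ω x a) ∨ (ρb = true ∧ G.Conn ω x b)))
    (hH' : ∀ ω, HubLike G v H ωᶜ (f ω)ᶜ
      (fun x => (ρa' = true ∧ G.Conn ωᶜ x a) ∨ (ρb' = true ∧ G.Conn ωᶜ x b))) :
    H.sliceCF f a b c = if ρa = true ∧ ρb = true then 0 else G.slackCF a b c := by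
  rw [sliceCF_eq_of_hubLike hav hbv hcv hH hH']
  simp only [closed_reach_clauses_iff]
  cases ρa <;> cases ρb
  · -- no open class: the slices are the cells of `G`
    rw [if_neg (by simp)]
    unfold slackCF
    simp only [Bool.false_eq_true, false_and, or_false, and_false]
  · -- the `b`-class open
    rw [if_neg (by simp)]
    unfold slackCF
    simp only [Bool.false_eq_true, false_and, false_or, true_and, reach_b_cell_ab_iff,
      reach_b_cell_ac_iff, reach_b_cell_n_iff]
  · -- the `a`-class open
    rw [if_neg (by simp)]
    unfold slackCF
    simp only [Bool.false_eq_true, false_and, or_false, true_and, reach_a_cell_ab_iff,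
      reach_a_cell_ac_iff, reach_a_cell_bc_iff, reach_a_cell_n_iff]
  · -- both classes open: the hub joins `a` and `b`
    rw [if_pos ⟨rfl, rfl⟩]
    simp only [true_and, open_pair_ab_conn_iff, open_pair_ab_not_ac_iff, open_pair_ab_cell_ac_iff,
      open_pair_ab_cell_bc_iff, Finset.filter_false, Finset.card_empty, Nat.cast_zero, add_zero]
    rw [sub_eq_zero, Nat.cast_inj]
    convert card_filter_compl (fun ω => ¬ G.Conn ω c a ∧ ¬ G.Conn ω c b) using 2 <;>
      (ext ω; simp only [Finset.mem_filter])

end ReachSlice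

end MultiGraph

end PercRepro
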